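import Summits.BirchSwinnertonDyer.BirchSwinnertonDyer.Theorems.SylvesterTwoHeegnerIndexCMHalfDecompositionAtThree
import Literature.NumberTheory.EllipticCurves.RingClassFieldAbelian
import HarnessLib

/-!
# (S10c, part 1) of leaf (L1) at `p ≡ 7 (mod 9)`, crux `UpperOffV0HSYPlus` (stmt-BirchSwinnertonDyer-19804): TOWER CFT FOR
# THE INVOLUTION OF THE DECOMPOSITION GROUP AT `w ∣ 3` — the pieces that discharge (W2-a) of the cell lemma W2

Skeleton VARIANT M 406ca288e244d392; planner D531 (3) (#S10).  After #S10a/#S10b (p688336 / p688827) the displayed tower fixing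
of `stub_layerL1Seven` reads `hTF′` = (W2-a) «an involution `φ_n` of `K[9pn]/K` lying in the decomposition group at `w ∣ 3`,
restricting to the bottom involution `s` (which fixes `∛3, ∛p`)» ∧ (W2-b) «`s·y₁ = y₁`, `φ_n·y_n = y_n`» (memo two §67.2).  (W2-a)
is class field theory of the tower (`φ_w = σ_{−1}·∏ e_ℓ`, `D_w = I_w × ⟨φ_w⟩ ≅ (ℤ/3)² × ℤ/2`); this file proves the tree
lemmas that let the sequel (part 2) CONSTRUCT `s` and `φ_n` — as ninth powers of the restriction of ONE local Frobenius
`σ_v ∈ Γ_{K_v}` — so that only (W2-b) remains displayed: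

* §1 `exists_decompositionBound_three_of_dvd` — #S10a's bound `#P ∣ 18` at level `9m` for any `m` with `3 ∤ m`, `p ∣ m` (the
  landed `exists_decompositionBound_three` is the case `m = pn`; needed here at `m = p`, the bottom `K[9p]`); same proof.
* §2 `apply_eq_self_of_sq_of_pow_three_eq` — an involution of a field `∋ ω` fixing `ω` fixes every cube root `c` of a fixed
  element: `s c = ζc` with `ζ³ = 1`, `ζ ∈ {1, ω, ω²}` fixed, `c = s(sc) = ζ²c`, so `ζ = 1`.  Whence `s ∛3 = ∛3`, `s ∛p = ∛p`
  for free.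
* §3 `exists_heightOneSpectrum_three_mem`, `HeightOneSpectrum.eq_of_three_mem` — the place of `K ∋ ω` above `3` exists and
  is unique (`(3) = w²`, k-ty1 `JZero.span_three_eq_asIdeal_sq`).
* §4 `restrictHom_apply_inclusion` — restrictions along two embeddings are COMPATIBLE through the inclusion `K[a] ≤ K[b]`:
  `r_b(g) ∘ incl = incl ∘ r_a(g)`, because two `K`-embeddings of the normal `K[a]` differ by an automorphism
  (Mathlib `AlgHom.restrictNormal'`) and `Gal(K[a]/K)` is ABELIAN (tree `isAbelianGalois_ringClassField`).

HONEST LABEL: theorems only (no `def`, no `sorry`, no new `Prop`); pure field theory / CFT of the tower; nothing asserted on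
19804; no stub closed; X12.CMAtTwo NOT proved; BSD is not proved by any of this, for any curve.
`--supports stmt-BirchSwinnertonDyer-19804 --as helper`.
-/

set_option linter.dupNamespace false
set_option autoImplicit false

noncomputable section

open scoped Classical Pointwise

namespace Summit.BirchSwinnertonDyer.BirchSwinnertonDyer.Theorems.SylvesterTwoCMHalf

open Field NumberField IsDedekindDomain IsDedekindDomain.HeightOneSpectrum Module
open Literature.NumberTheory.EllipticCurves Literature.NumberTheory.GaloisRepresentations
  Literature.NumberTheory.EllipticCurves.HuShuYin2019
  Literature.NumberTheory.EllipticCurves.RingClassField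
  Summit.BirchSwinnertonDyer.Rank1Residual.X11b Summit.BirchSwinnertonDyer.Rank1Residual.X11b.RingClassTower

variable {K : Type} [Field K] [NumberField K]

/-! ## §1 `#D_w(K[9m]/K) ∣ 18` for every conductor `m` with `3 ∤ m`, `p ∣ m` -/

set_option maxHeartbeats 1600000 in
/-- **`#D_w(K[9m]/K) ∣ 18`** (`K ∋ ω` quadratic, `p ≡ 1 (3)` prime, `3 ∤ m`, `p ∣ m`, `v ∋ 3`): the image of `Γ_{K_v}` in
`Gal(K[9m]/K)` along any `K`-embedding `e` and its restriction `r` lies in a subgroup of order dividing `18`.  #S10a's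
`exists_decompositionBound_three` is the case `m = pn`; same proof (inertia trivial on `K[m]`, Frobenius an involution on
`K[m]`, `[K[9m]:K[m]] = 9`). [cite: NeukirchANT1999, Ch. I §9 Prop. (9.4)–(9.6), Ch. II §9 Prop. (9.6)]
[cite: Cox2013, §9.A (9.1), Cor. 5.21] [cite: HuShuYin2019, §2.2 Prop. 2.4 (1) (PDF pp. 6–7)] -/
theorem exists_decompositionBound_three_of_dvd {ω : K} (hω : ω ^ 2 + ω + 1 = 0) (h2 : finrank ℚ K = 2)
    (ι : K →+* ℂ) {p m : ℕ} (hp : p.Prime) (hp3 : p % 3 = 1) (hm3 : ¬ 3 ∣ m) (hpm : p ∣ m)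
    (v : HeightOneSpectrum (𝓞 K)) (hv : ((3 : ℕ) : 𝓞 K) ∈ v.asIdeal)
    (e : ringClassField K ι (9 * m) →+* AlgebraicClosure K)
    (he : ∀ k : K, e (algebraMap K (ringClassField K ι (9 * m)) k) = algebraMap K (AlgebraicClosure K) k)
    (r : absoluteGaloisGroup K →* (ringClassField K ι (9 * m) ≃ₐ[K] ringClassField K ι (9 * m)))
    (hr : ∀ (g : absoluteGaloisGroup K) (x : ringClassField K ι (9 * m)),
      (show AlgebraicClosure K ≃ₐ[K] AlgebraicClosure K from g) (e x) = e (r g x))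
    (hrsurj : Function.Surjective r) :
    ∃ P : Subgroup (ringClassField K ι (9 * m) ≃ₐ[K] ringClassField K ι (9 * m)),
      Nat.card P ∣ 18 ∧
      ∀ τ : absoluteGaloisGroup (v.adicCompletion K), r (resGal (K := K) (v.adicCompletion K) τ) ∈ P := by
  have hK := JZero.isImaginaryQuadratic_of_sq_add_self_add_one hω h2
  -- ### the conductor `m`: `m ≠ 0`, `2 ≤ m`
  have hm0 : m ≠ 0 := by rintro rfl; exact hm3 (dvd_zero 3)
  have hm2 : 2 ≤ m := le_trans hp.two_le (Nat.le_of_dvd (Nat.pos_of_ne_zero hm0) hpm)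
  have h9m0 : 9 * m ≠ 0 := mul_ne_zero (by norm_num) hm0
  haveI := (finiteDimensional_and_isGalois_ringClassField hK ι h9m0).1
  haveI := (finiteDimensional_and_isGalois_ringClassField hK ι h9m0).2
  haveI := (finiteDimensional_and_isGalois_ringClassField hK ι hm0).1
  haveI := (finiteDimensional_and_isGalois_ringClassField hK ι hm0).2
  -- ### the sub-level `K[pn] ≤ K[9pn]` and its embedding `e' = e ∘ incl`
  have hle : ringClassField K ι m ≤ ringClassField K ι (9 * m) :=
    ringClassField_mono hK ι (Dvd.intro_left 9 rfl) h9m0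
  set e' : ringClassField K ι m →+* AlgebraicClosure K := e.comp (RingClassField.inclusion ι hle) with he'def
  have he' : ∀ k : K, e' (algebraMap K (ringClassField K ι m) k) = algebraMap K (AlgebraicClosure K) k := by
    intro k
    show e (RingClassField.inclusion ι hle (algebraMap K (ringClassField K ι m) k)) = _
    rw [(RingClassField.inclusion ι hle).commutes, he]
  have hcoh : ∀ x, e' x = e (RingClassField.inclusion ι hle x) := fun _ ↦ rfl
  obtain ⟨r₁, hr₁, hr₁surj, hr₁ker⟩ := exists_restrictHom hK ι hm0 e' he'
  -- `ker r ≤ ker r₁`: fixing `e(K[9pn])` fixes `e'(K[pn])`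
  have hker : r.ker ≤ r₁.ker := by
    intro g hg
    rw [MonoidHom.mem_ker] at hg ⊢
    refine AlgEquiv.ext fun y ↦ e'.injective ?_
    rw [← hr₁, AlgEquiv.one_apply, hcoh, hr, hg, AlgEquiv.one_apply]
  -- ### the restriction `ρ : Gal(K[9pn]/K) → Gal(K[pn]/K)`, `ρ ∘ r = r₁`
  set ρ := r.liftOfSurjective hrsurj ⟨r₁, hker⟩ with hρdef
  have hρ : ∀ g, ρ (r g) = r₁ g := fun g ↦ r.liftOfRightInverse_comp_apply _ _ ⟨r₁, hker⟩ g
  have hρsurj : Function.Surjective ρ := fun σ ↦ by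
    obtain ⟨g, rfl⟩ := hr₁surj σ
    exact ⟨r g, hρ g⟩
  -- `#ker ρ = 9`
  have hcard9 : Nat.card (ringClassField K ι (9 * m) ≃ₐ[K] ringClassField K ι (9 * m)) =
      9 * Nat.card (ringClassField K ι m ≃ₐ[K] ringClassField K ι m) := by
    rw [IsGalois.card_aut_eq_finrank, IsGalois.card_aut_eq_finrank]
    exact JZero.finrank_ringClassField_nine_mul hω h2 ι hm3 hm2
  have hkerρ : Nat.card ρ.ker = 9 := by
    have h1 := Subgroup.card_mul_index ρ.ker
    rw [Subgroup.index_ker, MonoidHom.range_eq_top.mpr hρsurj, Subgroup.card_top, hcard9] at h1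
    have hpos : 0 < Nat.card (ringClassField K ι m ≃ₐ[K] ringClassField K ι m) := Nat.card_pos
    exact Nat.eq_of_mul_eq_mul_right hpos h1
  -- ### the prime `𝔓` of `\bar ℤ_K` cut out by `K̄ → K̄_v`, a Frobenius `F` at `𝔓`, and its involution on `K[pn]`
  obtain ⟨𝔐, h𝔐⟩ := v.localPrimesAbove_nonempty
  have h𝔓 := v.primeBelow_mem_primesAbove (ι := closureEmb (K := K) (v.adicCompletion K)) h𝔐
  obtain ⟨F, hF⟩ := HeightOneSpectrum.exists_isArithFrobAt_of_mem_primesAbove_holds (v := v) h𝔓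
  obtain ⟨σ₀, -, -, hσ₀2, hσ₀F⟩ := JZero.exists_involution_apply_emb_eq_of_isArithFrobAt_three hω h2 ι v hv hm3 hp
    hp3 hpm e' he' h𝔓 hF
  have hF2 : r₁ F * r₁ F = 1 := by
    have h1 : ∀ y, r₁ F y = σ₀ y := fun y ↦ e'.injective (by rw [← hr₁]; exact hσ₀F y)
    refine AlgEquiv.ext fun y ↦ ?_
    rw [AlgEquiv.mul_apply, h1, h1, ← AlgEquiv.mul_apply, hσ₀2]; rfl
  -- ### `P := ρ⁻¹ ⟨r₁ F⟩`
  refine ⟨(Subgroup.zpowers (r₁ F)).comap ρ, ?_, fun τ ↦ ?_⟩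
  · -- `#P = #ker ρ · #(P.map ρ)`, `#(P.map ρ) ∣ #⟨r₁ F⟩ ∣ 2`
    set P := (Subgroup.zpowers (r₁ F)).comap ρ with hPdef
    have hkerle : ρ.ker ≤ P := fun x hx ↦ by
      rw [hPdef, Subgroup.mem_comap, MonoidHom.mem_ker.mp hx]; exact Subgroup.one_mem _
    have hmul : Nat.card ρ.ker * ρ.ker.relIndex P = Nat.card P := by
      rw [← Subgroup.relIndex_bot_left, ← Subgroup.relIndex_bot_left]
      exact Subgroup.relIndex_mul_relIndex ⊥ ρ.ker P bot_le hkerle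
    have hmap : ρ.ker.relIndex P ∣ 2 := by
      rw [Subgroup.relIndex_ker]
      have hle2 : P.map ρ ≤ Subgroup.zpowers (r₁ F) := Subgroup.map_comap_le _ _
      refine (Subgroup.card_dvd_of_le hle2).trans ?_
      rw [Nat.card_zpowers]
      exact orderOf_dvd_of_pow_eq_one (by rw [pow_two]; exact hF2)
    rw [← hmul, hkerρ, show (18 : ℕ) = 9 * 2 from rfl]
    exact mul_dvd_mul_left 9 hmap
  · -- `res τ ∈ D_𝔓 ⊆ S := r⁻¹ P` (closed submonoid containing `I_𝔓` and `F`)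
    set S : Subgroup (absoluteGaloisGroup K) := ((Subgroup.zpowers (r₁ F)).comap ρ).comap r with hSdef
    have hSmem : ∀ g : absoluteGaloisGroup K, g ∈ S ↔ r₁ g ∈ Subgroup.zpowers (r₁ F) := fun g ↦ by
      rw [hSdef, Subgroup.mem_comap, Subgroup.mem_comap, hρ]
    have hkerS : r₁.ker ≤ S := fun g hg ↦ by
      rw [hSmem, MonoidHom.mem_ker.mp hg]; exact Subgroup.one_mem _
    -- `S` is open (it contains `ker r₁`, open), hence closed
    have hSopen : IsOpen (S : Set (absoluteGaloisGroup K)) := Subgroup.isOpen_mono hkerS hr₁ker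
    have hSclosed : IsClosed (S : Set (absoluteGaloisGroup K)) := Subgroup.isClosed_of_isOpen S hSopen
    -- inertia: `K[pn]/K` is unramified at `v` (`3 ∤ pn`), so `I_𝔓` fixes `e'(K[pn])`, i.e. `r₁ i = 1`
    obtain ⟨N₁, hN₁⟩ := exists_subgroup_mem_iff e' he'
    have hunr : Algebra.IsUnramifiedIn (𝓞 (ringClassField K ι m)) v.asIdeal :=
      isUnramifiedIn_ringClassField hK ι hm0 (JZero.not_span_natCast_le_of_not_three_dvd v hv hm3)
    have hI : ∀ i ∈ (v.primeBelow (closureEmb (K := K) (v.adicCompletion K)) 𝔐).inertia (absoluteGaloisGroup K),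
        i ∈ (S : Set (absoluteGaloisGroup K)) := by
      intro i hi
      have hiN : i ∈ N₁ := mem_of_mem_inertia_of_isUnramifiedIn e' he' N₁ hN₁ v hunr h𝔓 hi
      have hi1 : r₁ i = 1 := by
        refine AlgEquiv.ext fun y ↦ e'.injective ?_
        rw [← hr₁, AlgEquiv.one_apply]
        exact (hN₁ i).mp hiN y
      show i ∈ S
      rw [hSmem, hi1]; exact Subgroup.one_mem _
    have hFS : F ∈ (S : Set (absoluteGaloisGroup K)) := by
      show F ∈ S
      rw [hSmem]; exact Subgroup.mem_zpowers _
    have hDS := decompositionSubgroup_subset_of_isClosed_of_frobenius_mem h𝔓 hF hSclosed S.one_mem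
      (fun g hg g' hg' ↦ S.mul_mem hg hg') hI hFS
    have hτD : resGal (K := K) (v.adicCompletion K) τ ∈
        (v.primeBelow (closureEmb (K := K) (v.adicCompletion K)) 𝔐).decompositionSubgroup (absoluteGaloisGroup K) :=
      resGalOfEmb_mem_decompositionSubgroup (closureEmb (K := K) (v.adicCompletion K)) h𝔐 τ
    have hτS : resGal (K := K) (v.adicCompletion K) τ ∈ S := hDS hτD
    rw [hSdef, Subgroup.mem_comap] at hτS
    exact hτS

/-! ## §2 An involution fixing `ω` fixes every cube root of a fixed element -/

/-- **Involutions fix cube roots.**  In a field `L ∋ ω` (`ω² + ω + 1 = 0`), if `s : L ≃+* L` satisfies `s (s x) = x`,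
`s ω = ω`, `s a = a` and `c³ = a ≠ 0`, then `s c = c`: `ζ := s c / c` is a cube root of unity, hence `∈ {1, ω, ω²}` and
fixed by `s`; `c = s (s c) = ζ² c` forces `ζ² = 1`, so `ζ = ζ³/ζ² = 1`.  (Why the bottom involution fixes `∛3, ∛p`
automatically.) [cite: Cox2013, §4.A (PDF p. 95: the units of ℤ[ω])] -/
theorem apply_eq_self_of_sq_of_pow_three_eq {L : Type*} [Field L] {ω : L} (hω : ω ^ 2 + ω + 1 = 0)
    (s : L ≃+* L) (hs2 : ∀ x, s (s x) = x) (hsω : s ω = ω) {c a : L} (hc : c ^ 3 = a) (ha : s a = a)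
    (ha0 : a ≠ 0) : s c = c := by
  have hc0 : c ≠ 0 := by rintro rfl; apply ha0; rw [← hc]; ring
  set ζ := s c / c with hζ
  have hsc : s c = ζ * c := by rw [hζ, div_mul_cancel₀ _ hc0]
  have hζ3 : ζ ^ 3 = 1 := by
    rw [hζ, div_pow, ← map_pow, hc, ha, div_self ha0]
  -- `ζ ∈ {1, ω, ω²}`
  have hfac : (ζ - 1) * (ζ - ω) * (ζ - ω ^ 2) = 0 := by
    linear_combination (ζ - 1) * (ω - 1 - ζ) * hω + hζ3
  have hsζ : s ζ = ζ := by
    rcases mul_eq_zero.mp hfac with h | h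
    · rcases mul_eq_zero.mp h with h | h
      · rw [sub_eq_zero.mp h, map_one]
      · rw [sub_eq_zero.mp h, hsω]
    · rw [sub_eq_zero.mp h, map_pow, hsω]
  -- `c = s (s c) = ζ² c`, so `ζ² = 1`
  have hζ2 : ζ ^ 2 = 1 := by
    have h := hs2 c
    rw [hsc, map_mul, hsζ, hsc, ← mul_assoc, ← pow_two] at h
    exact mul_right_cancel₀ hc0 (h.trans (one_mul c).symm)
  have hζ1 : ζ = 1 := by
    have : ζ ^ 3 = ζ * ζ ^ 2 := by ring
    rw [this, hζ2, mul_one] at hζ3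
    exact hζ3
  rw [hsc, hζ1, one_mul]

/-! ## §3 The place of `K ∋ ω` above `3`: existence and uniqueness -/

/-- `K` has a finite place above `3`. [folklore] -/
theorem exists_heightOneSpectrum_three_mem : ∃ v : HeightOneSpectrum (𝓞 K), ((3 : ℕ) : 𝓞 K) ∈ v.asIdeal := by
  -- adapted from Literature/NumberTheory/GaloisRepresentations/NearlyOrdinaryDeformationRingProofs.lean
  have hp := Nat.prime_three
  haveI : (Ideal.span {((3 : ℕ) : ℤ)}).IsMaximal :=
    Ideal.IsPrime.isMaximal (Ideal.span_singleton_prime (by exact_mod_cast hp.ne_zero) |>.2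
      (Nat.prime_iff_prime_int.1 hp)) (by
        rw [Ne, Ideal.span_singleton_eq_bot]; exact_mod_cast hp.ne_zero)
  obtain ⟨Q, hQmax, hQ⟩ := Ideal.exists_ideal_over_maximal_of_isIntegral (S := 𝓞 K)
    (Ideal.span {((3 : ℕ) : ℤ)}) (by
      rw [(RingHom.injective_iff_ker_eq_bot _).1 (algebraMap ℤ (𝓞 K)).injective_int]; exact bot_le)
  have hpQ : ((3 : ℕ) : 𝓞 K) ∈ Q := by
    have : ((3 : ℕ) : ℤ) ∈ Q.comap (algebraMap ℤ (𝓞 K)) := hQ ▸ Ideal.mem_span_singleton_self _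
    simpa using this
  refine ⟨⟨Q, hQmax.isPrime, fun h => ?_⟩, hpQ⟩
  rw [h] at hpQ
  have : ((3 : ℕ) : 𝓞 K) = 0 := hpQ
  exact hp.ne_zero (by exact_mod_cast this)

/-- **The place above `3` is unique** (`(3) = w²` is totally ramified in `K = ℚ(ω)`). [cite: NeukirchANT1999, Ch. I §10]
[cite: Cox2013, §4.A Prop. 4.7 (i)] -/
theorem HeightOneSpectrum.eq_of_three_mem {ω : K} (hω : ω ^ 2 + ω + 1 = 0) (h2 : finrank ℚ K = 2)
    {v w : HeightOneSpectrum (𝓞 K)} (hv : ((3 : ℕ) : 𝓞 K) ∈ v.asIdeal) (hw : ((3 : ℕ) : 𝓞 K) ∈ w.asIdeal) : v = w := by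
  have h := (JZero.span_three_eq_asIdeal_sq hω h2 v hv).symm.trans (JZero.span_three_eq_asIdeal_sq hω h2 w hw)
  have hdvd : v.asIdeal ∣ w.asIdeal ^ 2 := by rw [← h]; exact dvd_pow_self _ two_ne_zero
  have hdvd' : v.asIdeal ∣ w.asIdeal := (Ideal.prime_of_isPrime v.ne_bot v.isPrime).dvd_of_dvd_pow hdvd
  exact HeightOneSpectrum.ext ((w.isPrime.isMaximal w.ne_bot).eq_of_le v.isPrime.ne_top (Ideal.le_of_dvd hdvd')).symm

/-! ## §4 Restrictions along two embeddings are compatible through `K[a] ≤ K[b]` -/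

/-- **Compatibility of restrictions.**  `K` imaginary quadratic, `K[a] ≤ K[b]` ring class fields, `e₀ : K[a] → K̄` and
`e : K[b] → K̄` two `K`-embeddings with restriction homomorphisms `r₀`, `r` (`g ∘ e₀ = e₀ ∘ r₀ g`, `g ∘ e = e ∘ r g`).  Then
`r g (incl x) = incl (r₀ g x)`: the embedding `e ∘ incl` of `K[a]` is `e₀ ∘ α` for an `α ∈ Gal(K[a]/K)`
(Mathlib `AlgHom.restrictNormal'`), so `e ∘ incl` induces `α⁻¹ (r₀ g) α = r₀ g` — `Gal(K[a]/K)` is ABELIAN.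
[cite: GrossLMS1991, §3 (𝒢_n abelian; K_m ⊂ K_n)] [cite: Cox2013, §9.A (pp. 180–181)] -/
theorem restrictHom_apply_inclusion (hK : IsImaginaryQuadratic K) (ι : K →+* ℂ) {a b : ℕ} (ha0 : a ≠ 0)
    (hle : ringClassField K ι a ≤ ringClassField K ι b)
    (e₀ : ringClassField K ι a →+* AlgebraicClosure K)
    (he₀ : ∀ k : K, e₀ (algebraMap K (ringClassField K ι a) k) = algebraMap K (AlgebraicClosure K) k)
    (r₀ : absoluteGaloisGroup K →* (ringClassField K ι a ≃ₐ[K] ringClassField K ι a))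
    (hr₀ : ∀ (g : absoluteGaloisGroup K) (x : ringClassField K ι a),
      (show AlgebraicClosure K ≃ₐ[K] AlgebraicClosure K from g) (e₀ x) = e₀ (r₀ g x))
    (e : ringClassField K ι b →+* AlgebraicClosure K)
    (he : ∀ k : K, e (algebraMap K (ringClassField K ι b) k) = algebraMap K (AlgebraicClosure K) k)
    (r : absoluteGaloisGroup K →* (ringClassField K ι b ≃ₐ[K] ringClassField K ι b))
    (hr : ∀ (g : absoluteGaloisGroup K) (x : ringClassField K ι b),
      (show AlgebraicClosure K ≃ₐ[K] AlgebraicClosure K from g) (e x) = e (r g x))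
    (g : absoluteGaloisGroup K) (x : ringClassField K ι a) :
    r g (RingClassField.inclusion ι hle x) = RingClassField.inclusion ι hle (r₀ g x) := by
  haveI := (finiteDimensional_and_isGalois_ringClassField hK ι ha0).1
  haveI := (finiteDimensional_and_isGalois_ringClassField hK ι ha0).2
  haveI := isAbelianGalois_ringClassField hK ι ha0
  -- the second embedding of `K[a]` and the automorphism `α` with `e₀ ∘ α = e ∘ incl`
  set e₁ : ringClassField K ι a →+* AlgebraicClosure K := e.comp (RingClassField.inclusion ι hle) with he₁def
  have he₁ : ∀ k : K, e₁ (algebraMap K (ringClassField K ι a) k) = algebraMap K (AlgebraicClosure K) k := fun k ↦ by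
    show e (RingClassField.inclusion ι hle (algebraMap K (ringClassField K ι a) k)) = _
    rw [(RingClassField.inclusion ι hle).commutes, he]
  letI : Algebra (ringClassField K ι a) (AlgebraicClosure K) := e₀.toAlgebra
  haveI : IsScalarTower K (ringClassField K ι a) (AlgebraicClosure K) :=
    IsScalarTower.of_algebraMap_eq fun k ↦ (he₀ k).symm
  set φ₁ : ringClassField K ι a →ₐ[K] AlgebraicClosure K := AlgHom.mk e₁ he₁ with hφ₁
  set α : ringClassField K ι a ≃ₐ[K] ringClassField K ι a := φ₁.restrictNormal' (ringClassField K ι a) with hαdef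
  have hα : ∀ y, e₀ (α y) = e₁ y := fun y ↦ by
    have h := AlgHom.restrictNormal_commutes φ₁ (ringClassField K ι a) y
    rw [Algebra.algebraMap_self_apply] at h
    exact h
  -- `e (r g (incl x)) = g (e₁ x) = g (e₀ (α x)) = e₀ (r₀ g (α x))` and `e (incl (r₀ g x)) = e₀ (α (r₀ g x))`
  apply e.injective
  have hc : r₀ g * α = α * r₀ g := IsMulCommutative.is_comm.comm _ _
  have h1 : e (r g (RingClassField.inclusion ι hle x)) = e₀ (r₀ g (α x)) := by
    rw [← hr, show e (RingClassField.inclusion ι hle x) = e₁ x from rfl, ← hα, hr₀]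
  have h2 : e (RingClassField.inclusion ι hle (r₀ g x)) = e₀ (α (r₀ g x)) := by
    rw [show e (RingClassField.inclusion ι hle (r₀ g x)) = e₁ (r₀ g x) from rfl, ← hα]
  rw [h1, h2, ← AlgEquiv.mul_apply, hc, AlgEquiv.mul_apply]

end Summit.BirchSwinnertonDyer.BirchSwinnertonDyer.Theorems.SylvesterTwoCMHalf

end
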